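import Literature.MathematicalPhysics.QuantumLattice.HubbardNNNHopping
import Literature.MathematicalPhysics.QuantumLattice.HubbardModelParticleHoleProofs
import HarnessLib

/-!
# Particle–hole transformation of the `t–t'` Hubbard model: `t' ↦ -t'`, `N ↦ 2|Λ| - N`

Topic `Literature/MathematicalPhysics/QuantumLattice`; a companion of `HubbardNNNHopping.lean` (the
`t–t'` Hubbard Hamiltonian `hubbardTorusTT' L t t' U = hamiltonian (n.n. graph) t U +
hamiltonian (diagonal graph) t' 0` on the square torus `(ℤ/Lℤ)²`) and of
`HubbardModelParticleHoleProofs.lean` (Lieb's particle–hole unitary `P = particleHole ε'` and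
`P H(t,U) Pᴴ = H(t,U) - U N + U|Λ|` on a graph with a BIPARTITE sign `ε`).

## Content

* `hamiltonian_particleHole_sameSign` — the complementary operator identity: if the sign `ε` is
  CONSTANT along every edge of `G` (`ε x = ε y` for `x ∼ y`; e.g. next-nearest-neighbour bonds of a
  bipartite lattice, which join sites of the same sublattice), then
  `P H_G(t,U) Pᴴ = H_G(-t,U) - U N + U|Λ|`: the hopping amplitude changes sign
  (`P c†_{xσ}c_{yσ} Pᴴ = ε_x ε_y c_{xσ}c†_{yσ} = -c†_{yσ}c_{xσ}`).
* `groundEnergy_particleHole_transfer` — the variational transfer behind all sector statements, for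
  two arbitrary operators `H, H'` with `P H Pᴴ = H' - U N + c`: the Wave0 sector energies satisfy
  `E_H(2|Λ| - N) = E_{H'}(N) - U N + c` (`ψ ↦ Pᴴψ` is a bijection between unit `N`-particle and unit
  `(2|Λ| - N)`-particle vectors shifting the quadratic form by `c - U N`).
* `torusStagger_eq_of_diagAdj` — on the torus of even side the stagger `(-1)^{x₁+x₂}` is constant
  along diagonal bonds `y = x ± (e₁ ± e₂)`.
* `particleHole_hubbardTorusTT'` — on `(ℤ/Lℤ)²`, `L` even:
  `P H(t,t',U) Pᴴ = H(t,-t',U) - U N + U L²`;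
* `groundEnergy_hubbardTorusTT'_particleHole` (and the primed form) — the sector ground-state
  energies of the `t–t'` model satisfy `E_{t,t',U}(2L² - N) = E_{t,-t',U}(N) + U (L² - N)`:
  HOLE doping `δ` at next-nearest-neighbour hopping `t'` is ELECTRON doping `δ` at `-t'`, up to the
  explicit constant.  This is the exact dictionary used when benchmark tables quote `t'/t = -0.2` on the
  hole-doped side and `+0.2` on the electron-doped side (Lin–Hirsch 1987; LeBlanc et al. 2015 §5.3;
  Xu et al. 2024), and the `t' = 0` case is the tree's `groundEnergyAt_fermionTorus_particleHole`.

## Sources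

H. Q. Lin, J. E. Hirsch, *Two-dimensional Hubbard model with nearest- and next-nearest-neighbor
hopping*, PRB 35 (1987) 3359 (the `t–t'` model and its lack of particle–hole symmetry: `t' ↦ -t'`
under the transformation); E. H. Lieb, PRL 62 (1989) 1201 (the particle–hole unitary on bipartite
lattices); H. Tasaki, *Physics and Mathematics of Quantum Many-Body Systems* (2020) §9.3.3;
F. H. L. Essler et al., *The One-Dimensional Hubbard Model* (2005) §2.2.4 (Shiba transformation:
after eq. (2.60) the remark that a hopping term between two sites carrying the SAME sign "picks up a
minus sign", and that `N`-electron eigenstates map onto `(2L - N)`-electron eigenstates); E. H. Lieb,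
F. Y. Wu, Physica A 321 (2003) 1, §1 eq. (3) (`E(M,M') = -(N_a - N)U + E(N_a - M, N_a - M')`).
Everything here is elementary finite-dimensional algebra over the tree's Jordan–Wigner matrices; the
cite tags name the published statements being formalised, private helpers are [folklore].

## Not here

Rectangular tori `ℤ/aℤ × ℤ/bℤ` (needs a stagger on `Fin a ×ₗ Fin b`; same proof), spin-dependent
(partial) particle–hole maps `U ↦ -U`, and any statement about which sign of `t'` is "hole-like".
-/

noncomputable section

open Matrix Finset
open scoped ComplexOrder BigOperators

namespace Literature.MathematicalPhysics.QuantumLattice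

open HubbardWave0 Literature.Probability.LatticeModels

/-! ### Same-sublattice bonds: the hopping sign flips -/

section General

variable {Λ : Type*} [LinearOrder Λ] [Fintype Λ] (G : SimpleGraph Λ) [DecidableRel G.Adj]

/-- On a bond joining sites with EQUAL signs, `ε x ε y = 1` (in `ℂ`). [folklore] -/
private theorem intCast_units_mul_of_eq {u v : ℤˣ} (h : u = v) :
    (((u : ℤ) : ℂ)) * ((v : ℤ) : ℂ) = 1 := by
  subst h
  rcases Int.units_eq_one_or u with h | h <;> simp [h]

/-- **Particle–hole conjugation along same-sign bonds.** Let `ε : Λ → ℤˣ` be constant along every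
edge of `G` (`ε x = ε y` whenever `x ∼ y`) and `P = particleHole (ε ∘ site)`. Then
`P H_G(t, U) Pᴴ = H_G(-t, U) - U N + U |Λ|`: the hopping term changes sign
(`P c†_{xσ} c_{yσ} Pᴴ = ε_x ε_y c_{xσ} c†_{yσ} = -c†_{yσ} c_{xσ}` by the CAR) and
`P n_{x↑} n_{x↓} Pᴴ = (1 - n_{x↑})(1 - n_{x↓})`.  Companion of
`hamiltonian_particleHole_bipartite_holds` (opposite signs along edges, hopping invariant).
Essler et al. (2005) §2.2.4: under the transformation with alternating signs a hopping term between
two sites of EQUAL sign "picks up a minus sign" (remark after eq. (2.60)), the interaction maps as in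
eqs. (2.59)–(2.61); Lin–Hirsch, PRB 35 (1987) 3359 (the `t'` bonds); Lieb, PRL 62 (1989) 1201;
Tasaki (2020) §9.3.3. [cite: EsslerEtAl2005, §2.2.4 eqs. (2.59)–(2.61) and remark after (2.60)] -/
theorem hamiltonian_particleHole_sameSign (t U : ℝ) (ε : Λ → ℤˣ)
    (hε : ∀ x y, G.Adj x y → ε x = ε y) :
    particleHole (fun i : Orb Λ => ((ε (ofLex i).1 : ℤ) : ℂ)) * hamiltonian G t U *
        (particleHole (fun i : Orb Λ => ((ε (ofLex i).1 : ℤ) : ℂ)))ᴴ =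
      hamiltonian G (-t) U - (U : ℂ) • totalNumber +
        ((U * Fintype.card Λ : ℝ) : ℂ) • (1 : Matrix (Finset (Orb Λ)) (Finset (Orb Λ)) ℂ) := by
  set ε' : Orb Λ → ℂ := fun i => ((ε (ofLex i).1 : ℤ) : ℂ) with hε'
  have hn : ∀ i, ‖ε' i‖ = 1 := fun i => norm_intCast_units _
  set P := particleHole ε' with hP
  have hPP : Pᴴ * P = 1 := particleHole_conjTranspose_mul ε' hn
  have hsplit : ∀ A B : Matrix (Finset (Orb Λ)) (Finset (Orb Λ)) ℂ,
      P * (A * B) * Pᴴ = (P * A * Pᴴ) * (P * B * Pᴴ) := by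
    intro A B
    simp only [Matrix.mul_assoc]
    rw [← Matrix.mul_assoc Pᴴ P, hPP, Matrix.one_mul]
  -- hopping terms flip
  have hhop : ∀ (x y : Λ) (σ : Fin 2), G.Adj x y →
      P * (creation (orb x σ) * annihilation (orb y σ)) * Pᴴ =
        -(creation (orb y σ) * annihilation (orb x σ)) := by
    intro x y σ hxy
    have hne : orb x σ ≠ orb y σ := by
      intro h
      have := congrArg (fun i : Orb Λ => (ofLex i).1) h
      exact G.ne_of_adj hxy (by simpa using this)
    have hcar := annihilation_mul_creation_add_creation_mul_annihilation_holds (orb x σ) (orb y σ)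
    rw [if_neg hne] at hcar
    have hprod : ε' (orb x σ) * ε' (orb y σ) = 1 := by
      simp only [hε', orb, ofLex_toLex]
      exact intCast_units_mul_of_eq (hε x y hxy)
    rw [hsplit, particleHole_mul_creation_mul_conjTranspose ε' hn,
      particleHole_mul_annihilation_mul_conjTranspose_holds ε' hn, star_intCast_units,
      Matrix.smul_mul, Matrix.mul_smul, smul_smul,
      show ((ε (ofLex (orb x σ)).1 : ℤ) : ℂ) = ε' (orb x σ) from rfl,
      hprod, eq_neg_of_add_eq_zero_left hcar, one_smul]
  -- number operators
  have hnum : ∀ (x : Λ) (σ : Fin 2), P * numberOp x σ * Pᴴ = 1 - numberOp x σ := by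
    intro x σ
    have h := particleHole_mul_numberAt_mul_conjTranspose_holds ε' hn (orb x σ)
    simpa using h
  have hT : P * (∑ x : Λ, ∑ y : Λ, ∑ σ : Fin 2,
      if G.Adj x y then creation (orb x σ) * annihilation (orb y σ) else 0) * Pᴴ =
      -∑ x : Λ, ∑ y : Λ, ∑ σ : Fin 2,
        if G.Adj x y then creation (orb x σ) * annihilation (orb y σ) else 0 := by
    have h1 : ∀ (x y : Λ) (σ : Fin 2),
        P * (if G.Adj x y then creation (orb x σ) * annihilation (orb y σ) else 0) * Pᴴ =
          -(if G.Adj y x then creation (orb y σ) * annihilation (orb x σ) else 0) := by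
      intro x y σ
      by_cases hxy : G.Adj x y
      · rw [if_pos hxy, if_pos hxy.symm, hhop x y σ hxy]
      · rw [if_neg hxy, if_neg (fun h => hxy h.symm), Matrix.mul_zero, Matrix.zero_mul, neg_zero]
    simp only [Finset.mul_sum, Finset.sum_mul, h1, Finset.sum_neg_distrib]
    rw [Finset.sum_comm]
  have hV : P * (∑ x : Λ, numberOp x 0 * numberOp x 1) * Pᴴ =
      ∑ x : Λ, numberOp x 0 * numberOp x 1 - totalNumber +
        (Fintype.card Λ : ℂ) • (1 : Matrix (Finset (Orb Λ)) (Finset (Orb Λ)) ℂ) := by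
    simp only [Finset.mul_sum, Finset.sum_mul]
    have h1 : ∀ x : Λ, P * (numberOp x 0 * numberOp x 1) * Pᴴ =
        numberOp x 0 * numberOp x 1 - (numberOp x 0 + numberOp x 1) + 1 := by
      intro x
      rw [hsplit, hnum, hnum]
      noncomm_ring
    simp only [h1, Finset.sum_add_distrib, Finset.sum_sub_distrib, Finset.sum_const,
      Finset.card_univ]
    have h2 : (totalNumber : Matrix (Finset (Orb Λ)) (Finset (Orb Λ)) ℂ) =
        ∑ x : Λ, (numberOp x 0 + numberOp x 1) := by
      unfold totalNumber
      simp [Fin.sum_univ_two]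
    rw [h2, ← Nat.cast_smul_eq_nsmul ℂ, Finset.sum_add_distrib]
  unfold hamiltonian
  rw [Matrix.mul_add, Matrix.add_mul, Matrix.mul_smul, Matrix.smul_mul, Matrix.mul_smul,
    Matrix.smul_mul, hT, hV]
  push_cast
  module

/-! ### The variational transfer for a pair of conjugate operators -/

/-- **Sector energies under the particle–hole unitary (two-operator form).** Let `ε'` be
unimodular phases, `P = particleHole ε'`, and suppose `P H Pᴴ = H' - U N + c · 1`.  Then for
`N ≤ 2|Λ|` the Wave0 sector energies (infima of `Re ⟨ψ, · ψ⟩` over unit `N`-particle vectors)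
satisfy `E_H(2|Λ| - N) = E_{H'}(N) - U N + c`.  Proof: `ψ ↦ Pᴴψ` maps unit `N`-particle vectors
onto unit `(2|Λ| - N)`-particle vectors (inverse `φ ↦ Pφ`) and
`⟨Pᴴψ, H Pᴴψ⟩ = ⟨ψ, P H Pᴴ ψ⟩ = ⟨ψ, H'ψ⟩ - U N + c`; translate the variational set and its
infimum (`OrderIso.map_csInf'`).  Generalises the tree's `groundEnergyAt_particleHole` (`H' = H`).
Lieb–Wu, Physica A 321 (2003) 1, §1 eq. (3) (`E(M,M') = -(N_a-N)U + E(N_a-M, N_a-M')`);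
Essler et al. (2005) §2.2.4 after eq. (2.60); Tasaki (2020) §9.3.3.
[cite: LiebWuPhysicaA2003, §1 eq. (3)] -/
theorem groundEnergy_particleHole_transfer (ε' : Orb Λ → ℂ) (hn : ∀ i, ‖ε' i‖ = 1)
    {H H' : Matrix (Finset (Orb Λ)) (Finset (Orb Λ)) ℂ} {U c : ℝ}
    (hconj : particleHole ε' * H * (particleHole ε')ᴴ =
      H' - (U : ℂ) • totalNumber + (c : ℂ) • (1 : Matrix (Finset (Orb Λ)) (Finset (Orb Λ)) ℂ))
    {N : ℕ} (hN : N ≤ 2 * Fintype.card Λ) :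
    groundEnergy H (2 * Fintype.card Λ - N) = groundEnergy H' N - U * N + c := by
  set P := particleHole ε' with hP
  have hPP' : P * Pᴴ = 1 := particleHole_mul_conjTranspose ε' hn
  have hP'P : Pᴴ * P = 1 := particleHole_conjTranspose_mul ε' hn
  -- the variational sets
  set S : ℕ → Set ℝ := fun M =>
    {E : ℝ | ∃ ψ : Fock (Orb Λ), IsNParticle M ψ ∧ star ψ ⬝ᵥ ψ = 1 ∧
      E = (QuantumLattice.expect H ψ).re} with hS
  set S' : ℕ → Set ℝ := fun M =>
    {E : ℝ | ∃ ψ : Fock (Orb Λ), IsNParticle M ψ ∧ star ψ ⬝ᵥ ψ = 1 ∧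
      E = (QuantumLattice.expect H' ψ).re} with hS'
  have hE : ∀ M, groundEnergy H M = sInf (S M) := fun M => rfl
  have hE' : ∀ M, groundEnergy H' M = sInf (S' M) := fun M => rfl
  -- forward transfer `ψ ↦ Pᴴ ψ`
  have fwd : ∀ ψ : Fock (Orb Λ), IsNParticle N ψ → star ψ ⬝ᵥ ψ = 1 →
      IsNParticle (2 * Fintype.card Λ - N) (Pᴴ *ᵥ ψ) ∧ star (Pᴴ *ᵥ ψ) ⬝ᵥ (Pᴴ *ᵥ ψ) = 1 ∧
        (QuantumLattice.expect H (Pᴴ *ᵥ ψ)).re =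
          (QuantumLattice.expect H' ψ).re - U * N + c := by
    intro ψ hψN hψ1
    refine ⟨?_, ?_, ?_⟩
    · intro s hs
      rw [particleHole_conjTranspose_mulVec_apply]
      have hc : sᶜ.card ≠ N := by
        rw [Finset.card_compl, card_orb]
        have := s.card_le_univ
        rw [card_orb] at this
        omega
      rw [hψN _ hc, mul_zero]
    · rw [star_mulVec, conjTranspose_conjTranspose, ← dotProduct_mulVec, mulVec_mulVec, hPP',
        one_mulVec, hψ1]
    · have h1 : QuantumLattice.expect H (Pᴴ *ᵥ ψ) =
          QuantumLattice.expect H' ψ - (U : ℂ) * N + (c : ℂ) := by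
        unfold QuantumLattice.expect
        rw [star_mulVec, conjTranspose_conjTranspose, ← dotProduct_mulVec, mulVec_mulVec,
          mulVec_mulVec, hconj, add_mulVec, sub_mulVec, smul_mulVec, smul_mulVec, one_mulVec,
          totalNumber_mulVec_of_isNParticle hψN, dotProduct_add, dotProduct_sub, dotProduct_smul,
          dotProduct_smul, dotProduct_smul, hψ1]
        simp only [smul_eq_mul, mul_one]
      rw [h1]
      simp only [Complex.sub_re, Complex.add_re, Complex.ofReal_re, Complex.mul_re,
        Complex.ofReal_im, Complex.natCast_re, Complex.natCast_im, mul_zero, sub_zero]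
  -- backward transfer `φ ↦ P φ`
  have bwd : ∀ φ : Fock (Orb Λ), IsNParticle (2 * Fintype.card Λ - N) φ → star φ ⬝ᵥ φ = 1 →
      IsNParticle N (P *ᵥ φ) ∧ star (P *ᵥ φ) ⬝ᵥ (P *ᵥ φ) = 1 ∧ Pᴴ *ᵥ (P *ᵥ φ) = φ := by
    intro φ hφN hφ1
    refine ⟨?_, ?_, ?_⟩
    · intro s hs
      rw [hP, particleHole_mulVec_apply]
      have hc : sᶜ.card ≠ 2 * Fintype.card Λ - N := by
        rw [Finset.card_compl, card_orb]
        have := s.card_le_univ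
        rw [card_orb] at this
        omega
      rw [hφN _ hc, mul_zero]
    · rw [star_mulVec, ← dotProduct_mulVec, mulVec_mulVec, hP'P, one_mulVec, hφ1]
    · rw [mulVec_mulVec, hP'P, one_mulVec]
  -- the sets are translates of each other
  set d : ℝ := c - U * N with hd
  have hset : S (2 * Fintype.card Λ - N) = (OrderIso.addRight d) '' S' N := by
    ext E
    simp only [Set.mem_image, OrderIso.addRight_apply]
    constructor
    · rintro ⟨φ, hφN, hφ1, rfl⟩
      obtain ⟨h1, h2, h3⟩ := bwd φ hφN hφ1
      obtain ⟨-, -, h4⟩ := fwd (P *ᵥ φ) h1 h2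
      rw [h3] at h4
      refine ⟨(QuantumLattice.expect H' (P *ᵥ φ)).re, ⟨P *ᵥ φ, h1, h2, rfl⟩, ?_⟩
      rw [h4, hd]
      ring
    · rintro ⟨E₀, ⟨ψ, hψN, hψ1, rfl⟩, rfl⟩
      obtain ⟨h1, h2, h3⟩ := fwd ψ hψN hψ1
      exact ⟨Pᴴ *ᵥ ψ, h1, h2, by rw [h3, hd]; ring⟩
  -- nonempty and bounded below
  have hne : (S' N).Nonempty := by
    have hcard : N ≤ (Finset.univ : Finset (Orb Λ)).card := by
      rw [Finset.card_univ, card_orb]; exact hN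
    obtain ⟨s, -, hs⟩ := Finset.exists_subset_card_eq hcard
    refine ⟨_, Pi.single s 1, ?_, ?_, rfl⟩
    · intro s' hs'
      rw [Pi.single_apply, if_neg]
      rintro rfl
      exact hs' hs
    · rw [dotProduct_single, Pi.star_apply, Pi.single_eq_same, star_one, one_mul]
  have hbdd : BddBelow (S' N) := by
    refine ⟨-(∑ s, ∑ t, ‖H' s t‖), ?_⟩
    rintro E ⟨ψ, -, hψ1, rfl⟩
    exact neg_sum_norm_le_re_expect H' hψ1
  have key : sInf (S (2 * Fintype.card Λ - N)) = sInf (S' N) + d := by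
    rw [hset, ← OrderIso.map_csInf' (OrderIso.addRight d) hne hbdd, OrderIso.addRight_apply]
  rw [hE, hE', key, hd]
  ring

end General

/-! ### The square torus of even side: the stagger is constant along diagonal bonds -/

section Torus

variable {L : ℕ}

/-- One DIAGONAL step preserves the staggering sign on a torus of even side: if
`y ≡ x + (e₁ ± e₂) (mod L)` coordinatewise then `(-1)^{y₁+y₂} = (-1)^{x₁+x₂}` (the coordinate sums,
read in `ZMod 2` through `ZMod L → ZMod 2`, differ by `1 ± 1 ≡ 0`).  Lin–Hirsch, PRB 35 (1987)
3359 (next-nearest neighbours lie on the same sublattice). [folklore] -/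
private theorem torusStagger_eq_of_toTorusSite_eq_add_diagJump (hL : Even L) {x y : FermionTorus 2 L}
    {s : Fin 2} (h : FermionTorus.toTorusSite y = FermionTorus.toTorusSite x + torusDiagJump L s) :
    torusStagger y = torusStagger x := by
  have h2 : 2 ∣ L := even_iff_two_dvd.1 hL
  have hjump : ∑ j, ZMod.castHom h2 (ZMod 2) (torusDiagJump L s j) = 0 := by
    rw [Fin.sum_univ_two]
    have h10 : torusDiagJump L s 0 = 1 := by simp [torusDiagJump]
    have h11 : torusDiagJump L s 1 = 1 ∨ torusDiagJump L s 1 = -1 := by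
      fin_cases s <;> simp [torusDiagJump]
    rcases h11 with h | h
    · rw [h10, h, map_one]; decide
    · rw [h10, h, map_neg, map_one]; decide
  have hsum : ∑ j, ((ofLex y j : ℕ) : ZMod 2) = ∑ j, ((ofLex x j : ℕ) : ZMod 2) := by
    have := congrArg (fun v : TorusSite 2 L => ZMod.castHom h2 (ZMod 2) (∑ j, v j)) h
    simp only [FermionTorus.toTorusSite_apply, Pi.add_apply, sum_add_distrib, map_add, map_sum,
      map_natCast] at this
    rw [hjump, add_zero] at this
    exact this
  have key : (∑ j, (ofLex y j : ℕ)) % 2 = (∑ j, (ofLex x j : ℕ)) % 2 := by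
    apply (ZMod.natCast_eq_natCast_iff' _ _ 2).1
    push_cast
    exact hsum
  have hmod : ∀ (u : ℤˣ) (n : ℕ), u ^ n = u ^ (n % 2) := fun u n =>
    Int.units_pow_eq_pow_mod_two u n
  rw [torusStagger_apply, torusStagger_apply, hmod, key, ← hmod]

/-- On the torus `(ℤ/Lℤ)²` of even side, next-nearest (diagonal) neighbours carry EQUAL
staggering signs `(-1)^{x₁+x₂}`: the diagonal graph joins sites of the same sublattice (the two
sublattices `Γ₁, Γ₂` of a bipartite lattice, Essler et al. (2005) §2.2.4 after eq. (2.60); Lin–Hirsch,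
PRB 35 (1987) 3359). [cite: EsslerEtAl2005, §2.2.4, bipartite sublattices after eq. (2.60)] -/
theorem torusStagger_eq_of_diagAdj (hL : Even L) {x y : FermionTorus 2 L}
    (h : (fermionTorusDiagGraph L).Adj x y) : torusStagger x = torusStagger y := by
  have h' : (torusDiagGraph L).Adj (FermionTorus.toTorusSite x) (FermionTorus.toTorusSite y) := h
  rw [torusDiagGraph, SimpleGraph.fromRel_adj] at h'
  obtain ⟨-, ⟨s, hs⟩ | ⟨s, hs⟩⟩ := h'
  · exact (torusStagger_eq_of_toTorusSite_eq_add_diagJump hL hs).symm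
  · exact torusStagger_eq_of_toTorusSite_eq_add_diagJump hL hs

/-- **Particle–hole conjugation of the `t–t'` Hamiltonian on the even torus.** On `(ℤ/Lℤ)²` with
`L` even and `P` the particle–hole unitary with the staggered phases `(-1)^{x₁+x₂}`:
`P H(t, t', U) Pᴴ = H(t, -t', U) - U N + U L²` — the nearest-neighbour hopping is invariant
(bipartite bonds, `hamiltonian_particleHole_bipartite_holds`), the next-nearest-neighbour hopping
changes sign (same-sublattice bonds, `hamiltonian_particleHole_sameSign`).
Essler et al. (2005) §2.2.4 eqs. (2.59)–(2.61) and the remark after (2.60); Lin–Hirsch, PRB 35 (1987)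
3359; Lieb, PRL 62 (1989) 1201. [cite: EsslerEtAl2005, §2.2.4 eqs. (2.59)–(2.61)] -/
theorem particleHole_hubbardTorusTT' (hL : Even L) (t t' U : ℝ) :
    particleHole (fun i : Orb (FermionTorus 2 L) => ((torusStagger (ofLex i).1 : ℤ) : ℂ)) *
        hubbardTorusTT' L t t' U *
        (particleHole (fun i : Orb (FermionTorus 2 L) => ((torusStagger (ofLex i).1 : ℤ) : ℂ)))ᴴ =
      hubbardTorusTT' L t (-t') U - (U : ℂ) • totalNumber +
        ((U * L ^ 2 : ℝ) : ℂ) •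
          (1 : Matrix (Finset (Orb (FermionTorus 2 L))) (Finset (Orb (FermionTorus 2 L))) ℂ) := by
  have hNN := hamiltonian_particleHole_bipartite_holds (fermionTorusGraph 2 L) t U torusStagger
    (fun x y hxy => torusStagger_eq_neg_of_adj_holds hL hxy)
  have hNNN := hamiltonian_particleHole_sameSign (fermionTorusDiagGraph L) t' 0 torusStagger
    (fun x y hxy => torusStagger_eq_of_diagAdj hL hxy)
  have hcard : Fintype.card (FermionTorus 2 L) = L ^ 2 := by simp [FermionTorus, Fintype.card_lex]
  have key := congrArg₂ (· + ·) hNN hNNN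
  simp only [zero_mul, Complex.ofReal_zero, zero_smul, sub_zero, add_zero] at key
  rw [← Matrix.add_mul, ← Matrix.mul_add, ← hubbardTorusTT', add_right_comm, sub_add_eq_add_sub,
    ← hubbardTorusTT', hcard] at key
  push_cast at key ⊢
  convert key

/-- **Particle–hole symmetry of the `t–t'` sector energies** (even torus): for `L` even,
`N ≤ 2L²` and all `t, t', U`,
`E_{t,t',U}(2L² - N) = E_{t,-t',U}(N) - U N + U L²`, where `E_{t,t',U}(N) =
groundEnergy (hubbardTorusTT' L t t' U) N`.  In words: hole doping at next-nearest-neighbour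
hopping `t'` is electron doping at `-t'` up to the explicit constant `U (L² - N)`.  At `t' = 0` this is
the tree's `groundEnergyAt_fermionTorus_particleHole`.  Lieb–Wu, Physica A 321 (2003) 1, §1
eq. (3); Essler et al. (2005) §2.2.4; Lin–Hirsch, PRB 35 (1987) 3359.
[cite: LiebWuPhysicaA2003, §1 eq. (3)] -/
theorem groundEnergy_hubbardTorusTT'_particleHole (hL : Even L) (t t' U : ℝ) {N : ℕ}
    (hN : N ≤ 2 * L ^ 2) :
    groundEnergy (hubbardTorusTT' L t t' U) (2 * L ^ 2 - N) =
      groundEnergy (hubbardTorusTT' L t (-t') U) N - U * N + U * L ^ 2 := by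
  have hcard : Fintype.card (FermionTorus 2 L) = L ^ 2 := by simp [FermionTorus, Fintype.card_lex]
  have hn : ∀ i : Orb (FermionTorus 2 L), ‖((torusStagger (ofLex i).1 : ℤ) : ℂ)‖ = 1 :=
    fun i => norm_intCast_units _
  -- the conjugation identity, assembled from the two graph lemmas in the exact syntactic form the
  -- transfer lemma consumes (identity matrix and number operator as produced there)
  have hNN := hamiltonian_particleHole_bipartite_holds (fermionTorusGraph 2 L) t U torusStagger
    (fun x y hxy => torusStagger_eq_neg_of_adj_holds hL hxy)
  have hNNN := hamiltonian_particleHole_sameSign (fermionTorusDiagGraph L) t' 0 torusStagger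
    (fun x y hxy => torusStagger_eq_of_diagAdj hL hxy)
  have key := congrArg₂ (· + ·) hNN hNNN
  simp only [zero_mul, Complex.ofReal_zero, zero_smul, sub_zero, add_zero] at key
  rw [← Matrix.add_mul, ← Matrix.mul_add, ← hubbardTorusTT', add_right_comm, sub_add_eq_add_sub,
    ← hubbardTorusTT'] at key
  have h := groundEnergy_particleHole_transfer _ hn key (N := N) (by rw [hcard]; exact hN)
  rw [hcard] at h
  rw [h]
  push_cast
  ring

/-- The same symmetry read from the `N`-particle side: for `L` even and `N ≤ 2L²`,
`E_{t,t',U}(N) = E_{t,-t',U}(2L² - N) - (L² - N) U`.  Lieb–Wu, Physica A 321 (2003) 1, §1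
eq. (3); Lin–Hirsch, PRB 35 (1987) 3359. [cite: LiebWuPhysicaA2003, §1 eq. (3)] -/
theorem groundEnergy_hubbardTorusTT'_particleHole' (hL : Even L) (t t' U : ℝ) {N : ℕ}
    (hN : N ≤ 2 * L ^ 2) :
    groundEnergy (hubbardTorusTT' L t t' U) N =
      groundEnergy (hubbardTorusTT' L t (-t') U) (2 * L ^ 2 - N) - ((L ^ 2 : ℝ) - N) * U := by
  have h := groundEnergy_hubbardTorusTT'_particleHole hL t t' U (N := 2 * L ^ 2 - N)
    (Nat.sub_le _ _)
  rw [show 2 * L ^ 2 - (2 * L ^ 2 - N) = N by omega] at h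
  rw [h, Nat.cast_sub hN]
  push_cast
  ring

end Torus

end Literature.MathematicalPhysics.QuantumLattice
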